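import Mathlib
import Literature.MathematicalPhysics.QuantumFieldTheory.Balaban1983to89.T4CubeConvexExtension
import Literature.MathematicalPhysics.QuantumFieldTheory.Balaban1983to89.T4CubeChartExpHessian
import Literature.MathematicalPhysics.QuantumFieldTheory.Balaban1983to89.T4CubeShellBlocks
import Literature.MathematicalPhysics.QuantumFieldTheory.Balaban1983to89.T4CubeShellDoubling

/-!
# Cube-shell conditioning VI: the chart-transport seam — covariance transport through a cube chart, the convex
extension preserving an inside ∕ outside split, block sums along a bond enumeration, window congruence, and the
doubling step under convexity NEAR the window only

Landing edition «CubeShell VI» of the ideation cell `ym-nodeO-ideate` (seat P8, lens DUAL; memo `memos/ROUTE-p8.md`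
v7.3 §89, v7.4 §92, v7.5 §94 ff., companion G8b v3), over the landed modules I `T4CubeShellBlocks` and
V `T4CubeShellDoubling` of this directory and the pub-balaban kernel certificates `T4CubeChartTransport`,
`T4CubeChartGnomonic`, `T4CubeChartExp`, `T4CubeChartExpHessian`, `T4CubeConvexExtension` (used BY NAME; nothing of
theirs is re-proved).  Sorry-free; no `axiom`.

HONEST FRAMING.  BOOKKEEPING ONLY — change of variables, finite sums, dependence sets, set-integral congruence and one
composition; no estimate, no density of Bałaban's renormalisation programme, no window of the printed programme (the
caveat (WINDOW ≠ PRINT) of `T4CubeChartExp` stands untouched).  The file records, kernel-checked, that the STRUCTURAL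
hypotheses of module V's doubling step (`DependsOn` split `f = f₁ + f₂`, observables blind to blocks, a GLOBAL
`HessianBound (f₁ + f₂) λ`) are met by data transported from a cube chart of a group-valued fibre, with convexity asked
only NEAR the window:
* §T1 `cov_normLaw_exp_eq_cubeCov` — the covariance of two inserts under the windowed, tilted image law
  `normLaw ν (w·e^{H})` of a cube chart (`IsCubeImage`) IS module I's `cubeCov f S (F∘φ) (G∘φ)` with `f = jac − H∘φ`
  (change of variables [Durrett2019, Thm 1.6.9], three applications of the tree's
  `IsCubeImage.integral_normLaw_exp_eq_integral_cubeLaw`; covariance as in [GlimmJaffe1987, §4.3]);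
* §T2 `exists_hessianBound_extension_split` — the tree's LOCAL → GLOBAL convexity device
  (`T4CubeConvexExtension.exists_hessianBound_extension'`: `Hess f ≥ λ` on a cube `[-S',S']ⁿ` ⟹ a global `C²` `λ`-convex
  `g` with `g = f`, `Dg = Df` on `[-S,S]ⁿ`; the elementary coordinatewise construction `convexExt f = f∘σ + B Σᵢ η(xᵢ)` —
  cf. the general `C^{1,1}` convex-extension literature, arXiv:1501.05226, NOT used) PRESERVES AN INSIDE ∕ OUTSIDE SPLIT:
  for `f = f₁ + f₂`, `f₁` a function of the coordinates in `A₁`, `f₂` of those in `A₂ ⊇ A₁ᶜ` (local functions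
  [FriedliVelenik2017, Lemma 6.3]), the extension is `g₁ + g₂` with the SAME dependence sets, both `C²`
  [Spivak1965, Thm 2-2, Thm 2-3], agreeing with `f₁`, `f₂` to first order on the window;
* §T3 block sums along a bond enumeration `e : σ × Fin 3 ≃ Fin n` — a Hamiltonian built from one-block terms
  [FriedliVelenik2017, Def. 6.14 (6.24)] restricted to the bonds in `T` is a function of the coordinate block of `T`
  [FriedliVelenik2017, Lemma 6.3]; the two Haar log-Jacobians of the tree ARE such block sums (`gnoJac_eq_blockSum`,
  `expJac_eq_blockSum`, `expJacRep_eq_blockSum`, by `rfl`), so they split along ANY bond labelling; an observable of the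
  group-valued fibre blind to the bonds off `T` pulls back, through either (blockwise, `rfl`) fibre chart, to a function
  of the block of `T`;
* §T4 window congruence — `cubeMass ∕ cubeMean ∕ cubeCov ∕ shellMass ∕ shellMean ∕ shellCov` and the shell-gradient
  observables see `f, F, G, Df` ON THE WINDOW ONLY (integrals of functions agreeing on the domain of integration
  [Durrett2019, Thm 1.4.7 (v)]; partials from the derivative [Spivak1965, Thm 2-7]), packaged as
  `exists_hessianBound_extension_split_window`: the `(g₁, g₂)` of §T2 carry LITERALLY the same doubling-step data as `(f₁, f₂)`;
* §T5 `abs_cubeCov_le_doubling_local` — hence module V's `abs_cubeCov_le_doubling₀` holds under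
  `HessianBoundOn (f₁ + f₂) (cube n S') λ`, `S < S'`, only — the exact OUTPUT shape of the pub-balaban certificates
  `hessianBoundOn_expJacRep_add` (`λ = 2∕3 + μ`) ∕ `hessianBound_gnoJac_add` (`λ = μ − ½`), `μ` = a convexity modulus of
  the transported action near the window (a HYPOTHESIS, Bałaban-side; not sized anywhere in the tree).
WHAT THIS FILE DOES NOT CLAIM.  Nothing about NODE O, [Balaban1987RG1] Thm 2 ∕ (0.31) or any decay rate; no seed, no
leak estimate, no `C³` row bound; the convexity modulus `μ` is an input.  Proofs ours; cite tags name the printed sources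
of the bookkeeping facts (the tree certificates used by name are [folklore] kernel certificates with 0 cite of their own).
-/

set_option autoImplicit false

noncomputable section

open MeasureTheory Set
open scoped Topology

namespace Literature.MathematicalPhysics.QuantumFieldTheory.Balaban1983to89.T4CubeShellSeam

open Literature.Probability.Distributions (isCompact_cube)
open Literature.MathematicalPhysics.QuantumFieldTheory.Balaban1983to89.T4CubePoincare
open Literature.MathematicalPhysics.QuantumFieldTheory.Balaban1983to89.T4CubeShellBlocks
open Literature.MathematicalPhysics.QuantumFieldTheory.Balaban1983to89.T4CubeChartTransport
open Literature.MathematicalPhysics.QuantumFieldTheory.Balaban1983to89.T4CubeConvexExtension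
open Literature.MathematicalPhysics.QuantumFieldTheory.Balaban1983to89.T4TiltModulus (normLaw)
open Literature.MathematicalPhysics.QuantumFieldTheory.Balaban1983to89.T4CubeChartGnomonic (gnoJac gnoFibreChart gnoChart SU2)
open Literature.MathematicalPhysics.QuantumFieldTheory.Balaban1983to89.T4CubeChartExp (expJac expLogWeight expFibreChart expChart)
open Literature.MathematicalPhysics.QuantumFieldTheory.Balaban1983to89.T4CubeChartExpHessian (expJacRep)

/-! ## §T1 Covariance transport through a cube chart -/

section CovTransport

variable {Y : Type*} [MeasurableSpace Y] {ν : Measure Y} {w : Y → ℝ} {n : ℕ} {S : ℝ}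
  {φ : (Fin n → ℝ) → Y} {jac : (Fin n → ℝ) → ℝ}

/-- **COVARIANCE TRANSPORT.**  Under the chart hypothesis `IsCubeImage ν w n S φ jac` (the weighted law `w dν` is
the image of `e^{-jac} 1_{[-S,S]ⁿ} dx` under `φ`), for a tilt `e^{H}` and any `f = jac − H∘φ` on the window, the
covariance of two measurable inserts `F, G` under `normLaw ν (w e^{H})` is the cube covariance
`cubeCov f S (F∘φ) (G∘φ)` of module I (`T4CubeShellBlocks.cubeCov`).  [folklore: change of variables; the tree's
`IsCubeImage.integral_normLaw_exp_eq_integral_cubeLaw` applied to `F`, `G` and `(F − c)(G − c')`.]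
[cite: Durrett2019, Thm 1.6.9; GlimmJaffe1987, §4.3 (proof of Cor. 4.3.3)] -/
theorem cov_normLaw_exp_eq_cubeCov (hc : IsCubeImage ν w n S φ jac) {H : Y → ℝ} (hHm : Measurable H)
    (hint : Integrable (fun y => w y * Real.exp (H y)) ν) {f : (Fin n → ℝ) → ℝ}
    (hf : ∀ x ∈ cube n S, f x = jac x - H (φ x)) {F G : Y → ℝ} (hF : Measurable F) (hG : Measurable G) :
    ∫ y, (F y - ∫ t, F t ∂normLaw ν (fun y => w y * Real.exp (H y))) *
        (G y - ∫ t, G t ∂normLaw ν (fun y => w y * Real.exp (H y)))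
        ∂normLaw ν (fun y => w y * Real.exp (H y)) =
      cubeCov f S (fun x => F (φ x)) (fun x => G (φ x)) := by
  have h1F : ∫ t, F t ∂normLaw ν (fun y => w y * Real.exp (H y)) = cubeMean f S (fun x => F (φ x)) := by
    rw [hc.integral_normLaw_exp_eq_integral_cubeLaw hHm hint hf hF, integral_cubeLaw_eq_cubeMean]
  have h1G : ∫ t, G t ∂normLaw ν (fun y => w y * Real.exp (H y)) = cubeMean f S (fun x => G (φ x)) := by
    rw [hc.integral_normLaw_exp_eq_integral_cubeLaw hHm hint hf hG, integral_cubeLaw_eq_cubeMean]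
  have hm : Measurable fun y =>
      (F y - cubeMean f S (fun x => F (φ x))) * (G y - cubeMean f S (fun x => G (φ x))) :=
    (hF.sub_const _).mul (hG.sub_const _)
  rw [h1F, h1G, hc.integral_normLaw_exp_eq_integral_cubeLaw hHm hint hf hm, integral_cubeLaw_eq_cubeMean]
  rfl

end CovTransport

/-! ## §T2 The local-to-global convexity seam preserves an inside ∕ outside split -/

section Split

variable {n : ℕ}

/-- A function of the coordinates in `A`, precomposed with the coordinatewise saturation `satMap`, is again a
function of the coordinates in `A`. [cite: FriedliVelenik2017, Lemma 6.3] -/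
theorem dependsOn_comp_satMap {f : (Fin n → ℝ) → ℝ} {A : Set (Fin n)} (hf : DependsOn f A) (a b : ℝ) :
    DependsOn (fun x => f (satMap a b x)) A :=
  fun x y hxy => hf fun i hi => by
    show T4CubeConvexExtension.cubeSat a b (x i) = T4CubeConvexExtension.cubeSat a b (y i)
    rw [hxy i hi]

/-- A collar sum over the coordinates in `T` is a function of those coordinates.
[cite: FriedliVelenik2017, Lemma 6.3; FriedliVelenik2017, Def. 6.14 (6.24)] -/
theorem dependsOn_collarSum (B r₀ r₁ : ℝ) (T : Finset (Fin n)) :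
    DependsOn (fun x : Fin n → ℝ => B * ∑ i ∈ T, cubeCollar r₀ r₁ (x i)) (↑T : Set (Fin n)) :=
  fun x y hxy => by
    show B * ∑ i ∈ T, cubeCollar r₀ r₁ (x i) = B * ∑ i ∈ T, cubeCollar r₀ r₁ (y i)
    rw [Finset.sum_congr rfl fun i hi => by rw [hxy i (Finset.mem_coe.2 hi)]]

/-- ONE PIECE of the split extension: `f(σx) + B Σ_{i ∈ T} η(xᵢ)`.
[folklore] [cite: FriedliVelenik2017, Def. 6.14 (6.24); FriedliVelenik2017, Lemma 6.3] -/
def piece (f : (Fin n → ℝ) → ℝ) (r₀ r₁ r₂ B : ℝ) (T : Finset (Fin n)) (x : Fin n → ℝ) : ℝ :=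
  f (satMap r₁ r₂ x) + B * ∑ i ∈ T, cubeCollar r₀ r₁ (x i)

/-- The two pieces add up to the tree's extension of the sum: `convexExt (f₁+f₂) = piece f₁ T + piece f₂ Tᶜ`.
[cite: FriedliVelenik2017, Def. 6.14 (6.24)] -/
theorem piece_add_piece (f₁ f₂ : (Fin n → ℝ) → ℝ) (r₀ r₁ r₂ B : ℝ) (T : Finset (Fin n)) :
    piece f₁ r₀ r₁ r₂ B T + piece f₂ r₀ r₁ r₂ B Tᶜ = convexExt (f₁ + f₂) r₀ r₁ r₂ B := by
  funext x
  simp only [piece, convexExt, Pi.add_apply]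
  rw [← Finset.sum_add_sum_compl T fun i => cubeCollar r₀ r₁ (x i)]
  ring

/-- A piece built on `f` depending on `A`, with collar indices `T ⊆ A`, depends on `A`.
[cite: FriedliVelenik2017, Lemma 6.3] -/
theorem dependsOn_piece {f : (Fin n → ℝ) → ℝ} {A : Set (Fin n)} (hf : DependsOn f A) (r₀ r₁ r₂ B : ℝ)
    {T : Finset (Fin n)} (hT : (↑T : Set (Fin n)) ⊆ A) : DependsOn (piece f r₀ r₁ r₂ B T) A :=
  fun x y hxy => by
    have h1 := dependsOn_comp_satMap hf r₁ r₂ hxy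
    have h2 := dependsOn_collarSum B r₀ r₁ T fun i hi => hxy i (hT hi)
    simp only at h1 h2
    unfold piece
    rw [h1, h2]

/-- Each piece is `C²` for `f ∈ C²`. [cite: Spivak1965, Thm 2-2 (chain rule), Thm 2-3] -/
theorem contDiff_piece {f : (Fin n → ℝ) → ℝ} (hf : ContDiff ℝ 2 f) (r₀ r₁ r₂ B : ℝ) (T : Finset (Fin n)) :
    ContDiff ℝ 2 (piece f r₀ r₁ r₂ B T) := by
  unfold piece
  refine (hf.comp (contDiff_satMap r₁ r₂ (m := 2))).add (contDiff_const.mul (ContDiff.sum fun i _ => ?_))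
  exact (contDiff_infty.1 (contDiff_cubeCollar r₀ r₁) 2).comp (contDiff_apply ℝ ℝ i)

/-- Each piece agrees with its `f` on the inner cube `[-r₀,r₀]ⁿ` (`r₀ < r₁ < r₂`).
[cite: FriedliVelenik2017, Lemma 6.3; Spivak1965, Thm 2-2 (chain rule), Thm 2-3] -/
theorem piece_eq {f : (Fin n → ℝ) → ℝ} {r₀ r₁ r₂ : ℝ} (h01 : r₀ < r₁) (h12 : r₁ < r₂) (B : ℝ)
    (T : Finset (Fin n)) {x : Fin n → ℝ} (hx : x ∈ cube n r₀) : piece f r₀ r₁ r₂ B T x = f x := by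
  have hx1 : x ∈ cube n r₁ := cube_subset_cube h01.le hx
  unfold piece
  rw [satMap_eq_self h12 hx1,
    Finset.sum_eq_zero (fun i _ => cubeCollar_eq_zero h01 (mem_cube_iff.1 hx i)), mul_zero, add_zero]

/-- **THE SEAM (local → global convexity with the split preserved).**  `0 ≤ S < S'`; `f₁, f₂ ∈ C²(ℝⁿ)`, `f₁` a
function of the coordinates in `A₁`, `f₂` of those in `A₂ ⊇ A₁ᶜ`; `Hess(f₁ + f₂) ≥ λ` on the cube `[-S',S']ⁿ` ONLY.
Then there are `g₁, g₂ ∈ C²(ℝⁿ)` with the SAME dependence sets, `Hess(g₁ + g₂) ≥ λ` EVERYWHERE (the same `λ`), and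
`gᵢ = fᵢ`, `Dgᵢ = Dfᵢ` on the window `[-S,S]ⁿ`.  (So the structural hypotheses `hf₁ hf₂ hB hf₁d hf₂d` of G8's
`abs_cubeCov_le_doubling'` hold for `(g₁, g₂)` as soon as `f₁ + f₂` is `λ`-convex NEAR the window, and every
window quantity — `cubeCov`, `shellCov`, the shell gradients `∂_j f₁` — is unchanged.)  [folklore: the tree's
`T4CubeConvexExtension.exists_hessianBound_extension'` ∕ `hessianBound_convexExt`, split by `piece_add_piece`.]
[cite: FriedliVelenik2017, Lemma 6.3; FriedliVelenik2017, Def. 6.14 (6.24); Spivak1965, Thm 2-2 (chain rule), Thm 2-3] -/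
theorem exists_hessianBound_extension_split {S S' lam : ℝ} (hS : 0 ≤ S) (hSS' : S < S')
    {f₁ f₂ : (Fin n → ℝ) → ℝ} (hf₁ : ContDiff ℝ 2 f₁) (hf₂ : ContDiff ℝ 2 f₂) {A₁ A₂ : Set (Fin n)}
    (hd₁ : DependsOn f₁ A₁) (hd₂ : DependsOn f₂ A₂) (hA : A₁ᶜ ⊆ A₂)
    (hB : HessianBoundOn (f₁ + f₂) (cube n S') lam) :
    ∃ g₁ g₂ : (Fin n → ℝ) → ℝ, ContDiff ℝ 2 g₁ ∧ ContDiff ℝ 2 g₂ ∧ DependsOn g₁ A₁ ∧ DependsOn g₂ A₂ ∧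
      HessianBound (g₁ + g₂) lam ∧ (∀ x ∈ cube n S, g₁ x = f₁ x) ∧ (∀ x ∈ cube n S, g₂ x = f₂ x) ∧
      (∀ x ∈ cube n S, fderiv ℝ g₁ x = fderiv ℝ f₁ x) ∧ ∀ x ∈ cube n S, fderiv ℝ g₂ x = fderiv ℝ f₂ x := by
  classical
  have hf : ContDiff ℝ 2 (f₁ + f₂) := hf₁.add hf₂
  obtain ⟨C, hC⟩ := (isCompact_cube n S').exists_bound_of_continuousOn
    ((hf.continuous_fderiv (by norm_num)).continuousOn)
  obtain ⟨M₂, -, hM₂⟩ := exists_bound_deriv_cubePlateau (a := (S + 3 * S') / 4) (b := S') (by linarith)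
  set T : Finset (Fin n) := Finset.univ.filter (fun i => i ∈ A₁) with hT
  have hT₁ : (↑T : Set (Fin n)) ⊆ A₁ := fun i hi => by simpa [hT] using hi
  have hT₂ : (↑Tᶜ : Set (Fin n)) ⊆ A₂ := fun i hi => hA (by simpa [hT] using hi)
  have h01 : (S + S') / 2 < (S + 3 * S') / 4 := by linarith
  have h12 : (S + 3 * S') / 4 < S' := by linarith
  have hlt : S < (S + S') / 2 := by linarith
  refine ⟨piece f₁ ((S + S') / 2) ((S + 3 * S') / 4) S' (|lam| + max C 0 * M₂) T,
    piece f₂ ((S + S') / 2) ((S + 3 * S') / 4) S' (|lam| + max C 0 * M₂) Tᶜ,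
    contDiff_piece hf₁ _ _ _ _ _, contDiff_piece hf₂ _ _ _ _ _, dependsOn_piece hd₁ _ _ _ _ hT₁,
    dependsOn_piece hd₂ _ _ _ _ hT₂, ?_, fun x hx => piece_eq h01 h12 _ _ (cube_subset_cube hlt.le hx),
    fun x hx => piece_eq h01 h12 _ _ (cube_subset_cube hlt.le hx), fun x hx => ?_, fun x hx => ?_⟩
  · rw [piece_add_piece]
    exact hessianBound_convexExt hf h01 h12 (by linarith) hB (le_max_right C 0)
      (fun y hy => (hC y hy).trans (le_max_left C 0)) hM₂ le_rfl
  · exact (Filter.eventuallyEq_of_mem (cube_mem_nhds hlt hx) fun y hy => piece_eq h01 h12 _ T hy).fderiv_eq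
  · exact (Filter.eventuallyEq_of_mem (cube_mem_nhds hlt hx) fun y hy => piece_eq h01 h12 _ Tᶜ hy).fderiv_eq

end Split

/-! ## §T3 Block sums along a bond enumeration: the Haar log-Jacobians and the blind observables split -/

section Blocks

variable {n : ℕ} {σ : Type*} [Fintype σ]

/-- A BLOCK SUM `Σ_b g_b(x_{e(b,·)})` along an enumeration `e : σ × Fin 3 ≃ Fin n` of the coordinates by bonds.
[folklore] [cite: FriedliVelenik2017, Def. 6.14 (6.24)] -/
def blockSum (e : σ × Fin 3 ≃ Fin n) (g : σ → (Fin 3 → ℝ) → ℝ) (x : Fin n → ℝ) : ℝ :=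
  ∑ b, g b (fun i => x (e (b, i)))

/-- The coordinate block of a set of bonds `T`.
[folklore] [cite: FriedliVelenik2017, Def. 6.14 (6.24); FriedliVelenik2017, Lemma 6.3] -/
def blockSet (e : σ × Fin 3 ≃ Fin n) (T : Set σ) : Set (Fin n) := {k | (e.symm k).1 ∈ T}

omit [Fintype σ] in
/-- A coordinate of a bond in `T` lies in the block of `T`. [cite: FriedliVelenik2017, Def. 6.14 (6.24)] -/
theorem apply_mem_blockSet (e : σ × Fin 3 ≃ Fin n) (T : Set σ) (b : σ) (i : Fin 3) :
    e (b, i) ∈ blockSet e T ↔ b ∈ T := by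
  simp [blockSet]

omit [Fintype σ] in
/-- The block of the complement is the complement of the block. [cite: FriedliVelenik2017, Def. 6.14 (6.24)] -/
theorem blockSet_compl (e : σ × Fin 3 ≃ Fin n) (T : Set σ) : blockSet e Tᶜ = (blockSet e T)ᶜ := rfl

omit [Fintype σ] in
/-- Blocks of a bond LABELLING `labB : σ → Fin 3` are the label sets of the induced coordinate labelling
`lab k = labB (e.symm k).1` — the form in which G8 states inside ∕ shell ∕ outside.
[cite: FriedliVelenik2017, Def. 6.14 (6.24)] -/
theorem blockSet_label (e : σ × Fin 3 ≃ Fin n) (labB : σ → Fin 3) (U : Set (Fin 3)) :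
    blockSet e {b | labB b ∈ U} = {k | labB (e.symm k).1 ∈ U} := rfl

omit [Fintype σ] in
/-- A partial block sum over the bonds in `T` is a function of the coordinate block of `T`.
[cite: FriedliVelenik2017, Def. 6.14 (6.24); FriedliVelenik2017, Lemma 6.3] -/
theorem dependsOn_blockSum_finset (e : σ × Fin 3 ≃ Fin n) (g : σ → (Fin 3 → ℝ) → ℝ) (T : Finset σ) :
    DependsOn (fun x : Fin n → ℝ => ∑ b ∈ T, g b (fun i => x (e (b, i)))) (blockSet e ↑T) :=
  fun x y hxy => by
    show ∑ b ∈ T, g b (fun i => x (e (b, i))) = ∑ b ∈ T, g b (fun i => y (e (b, i)))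
    exact Finset.sum_congr rfl fun b hb =>
      congrArg (g b) (funext fun i => hxy _ ((apply_mem_blockSet e _ b i).2 (Finset.mem_coe.2 hb)))

/-- A block sum SPLITS along any set of bonds `T` into two partial block sums.
[cite: FriedliVelenik2017, Def. 6.14 (6.24)] -/
theorem blockSum_eq_add [DecidableEq σ] (e : σ × Fin 3 ≃ Fin n) (g : σ → (Fin 3 → ℝ) → ℝ) (T : Finset σ) :
    blockSum e g = (fun x => ∑ b ∈ T, g b (fun i => x (e (b, i)))) +
      fun x => ∑ b ∈ Tᶜ, g b (fun i => x (e (b, i))) := by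
  funext x
  simp only [blockSum, Pi.add_apply]
  exact (Finset.sum_add_sum_compl T _).symm

/-- Packaged: a block sum is `J₁ + J₂` with `J₁` a function of the block of `T`, `J₂` of the block of `Tᶜ`.
[cite: FriedliVelenik2017, Def. 6.14 (6.24); FriedliVelenik2017, Lemma 6.3] -/
theorem blockSum_split [DecidableEq σ] (e : σ × Fin 3 ≃ Fin n) (g : σ → (Fin 3 → ℝ) → ℝ) (T : Finset σ) :
    ∃ J₁ J₂ : (Fin n → ℝ) → ℝ, blockSum e g = J₁ + J₂ ∧ DependsOn J₁ (blockSet e ↑T) ∧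
      DependsOn J₂ (blockSet e ↑Tᶜ) :=
  ⟨_, _, blockSum_eq_add e g T, dependsOn_blockSum_finset e g T, dependsOn_blockSum_finset e g Tᶜ⟩

omit [Fintype σ] in
/-- An observable of the block-valued fibre that is blind to the blocks off `T`, pulled back through ANY blockwise
chart `x ↦ (b ↦ c_b(x_{e(b,·)}))`, is a function of the coordinate block of `T`.
[cite: FriedliVelenik2017, Lemma 6.3] -/
theorem dependsOn_comp_blockChart {G β : Type*} (e : σ × Fin 3 ≃ Fin n) (c : σ → (Fin 3 → ℝ) → G)
    {F : (σ → G) → β} {T : Set σ} (hF : DependsOn F T) :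
    DependsOn (fun x : Fin n → ℝ => F (fun b => c b (fun i => x (e (b, i))))) (blockSet e T) :=
  fun _ _ hxy => hF fun b hb => congrArg (c b) (funext fun i => hxy _ ((apply_mem_blockSet e T b i).2 hb))

variable {P : Params} {j : ℕ} {s : Finset (PBond P j)}

/-- The GNOMONIC Haar log-Jacobian of the tree is a block sum (by `rfl`).
[cite: FriedliVelenik2017, Def. 6.14 (6.24)] -/
theorem gnoJac_eq_blockSum (e : ↥s × Fin 3 ≃ Fin n) :
    gnoJac s e = blockSum e fun _ v => Real.log (2 * Real.pi ^ 2) + 2 * Real.log (1 + ∑ i : Fin 3, v i ^ 2) :=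
  rfl

/-- The EXPONENTIAL Haar log-Jacobian of the tree is a block sum (by `rfl`).
[cite: FriedliVelenik2017, Def. 6.14 (6.24)] -/
theorem expJac_eq_blockSum (e : ↥s × Fin 3 ≃ Fin n) : expJac s e = blockSum e fun _ => expLogWeight := rfl

/-- The tree's GLOBAL `C²` representative `expJacRep = expJac ∘ satMap S₁ S₂` of the exponential log-Jacobian
(`T4CubeChartExpHessian`; Hessian floor `2/3` on cubes with `3 S₂² < π²`, `hessianBoundOn_expJacRep`) is a block sum
too (by `rfl`: the saturation is coordinatewise). [cite: FriedliVelenik2017, Def. 6.14 (6.24)] -/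
theorem expJacRep_eq_blockSum (e : ↥s × Fin 3 ≃ Fin n) (S₁ S₂ : ℝ) :
    expJacRep s e S₁ S₂ =
      blockSum e fun _ v => expLogWeight fun i => T4CubeConvexExtension.cubeSat S₁ S₂ (v i) :=
  rfl

/-- Both fibre charts of the tree are blockwise (by `rfl`), so `dependsOn_comp_blockChart` applies to them.
[cite: FriedliVelenik2017, Lemma 6.3] -/
theorem gnoFibreChart_apply (u₀ : GaugeField P j SU2) (e : ↥s × Fin 3 ≃ Fin n) (x : Fin n → ℝ) (b : ↥s) :
    gnoFibreChart s u₀ e x b = gnoChart (u₀ b) (fun i => x (e (b, i))) := rfl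

/-- The exponential fibre chart is blockwise (by `rfl`). [cite: FriedliVelenik2017, Lemma 6.3] -/
theorem expFibreChart_apply (u₀ : GaugeField P j SU2) (e : ↥s × Fin 3 ≃ Fin n) (x : Fin n → ℝ) (b : ↥s) :
    expFibreChart s u₀ e x b = expChart (u₀ b) (fun i => x (e (b, i))) := rfl

/-- Hence: an observable of the `SU(2)`-fibre blind to the bonds off `T`, read through the gnomonic fibre chart,
is a function of the coordinate block of `T`. [cite: FriedliVelenik2017, Lemma 6.3] -/
theorem dependsOn_comp_gnoFibreChart {β : Type*} (u₀ : GaugeField P j SU2) (e : ↥s × Fin 3 ≃ Fin n)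
    {F : (↥s → SU2) → β} {T : Set ↥s} (hF : DependsOn F T) :
    DependsOn (fun x => F (gnoFibreChart s u₀ e x)) (blockSet e T) :=
  dependsOn_comp_blockChart e (fun b v => gnoChart (u₀ b) v) hF

/-- The gnomonic log-Jacobian SPLITS along any set of bonds `T` with the induced coordinate dependence:
`gnoJac = J₁ + J₂`, `J₁` a function of the block of `T`, `J₂` of the block of `Tᶜ`.
[cite: FriedliVelenik2017, Def. 6.14 (6.24); FriedliVelenik2017, Lemma 6.3] -/
theorem gnoJac_split [DecidableEq ↥s] (e : ↥s × Fin 3 ≃ Fin n) (T : Finset ↥s) :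
    ∃ J₁ J₂ : (Fin n → ℝ) → ℝ, gnoJac s e = J₁ + J₂ ∧ DependsOn J₁ (blockSet e ↑T) ∧
      DependsOn J₂ (blockSet e ↑Tᶜ) := by
  rw [gnoJac_eq_blockSum]
  exact blockSum_split e _ T

/-- The same for the exponential chart's global representative `expJacRep`.
[cite: FriedliVelenik2017, Def. 6.14 (6.24); FriedliVelenik2017, Lemma 6.3] -/
theorem expJacRep_split [DecidableEq ↥s] (e : ↥s × Fin 3 ≃ Fin n) (S₁ S₂ : ℝ) (T : Finset ↥s) :
    ∃ J₁ J₂ : (Fin n → ℝ) → ℝ, expJacRep s e S₁ S₂ = J₁ + J₂ ∧ DependsOn J₁ (blockSet e ↑T) ∧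
      DependsOn J₂ (blockSet e ↑Tᶜ) := by
  rw [expJacRep_eq_blockSum]
  exact blockSum_split e _ T

end Blocks

/-! ## §T4 Window congruence: every quantity of the doubling step is WINDOW-DETERMINED

`cubeMass`, `cubeMean`, `cubeCov` (`T4CubePoincare`, module I) and `shellMass`, `shellMean`, `shellCov` (module I) are
set integrals over `cube n S` of expressions evaluated at points of the window (`merge lab x z ∈ cube n S` for
`x, z ∈ cube n S`, `merge_mem_cube`), so they only see `f`, `F`, `G` ON the window; the shell-gradient observables
`y ↦ coordGradient f y j` only see `fderiv ℝ f` on the window.  Consequently the pair `(g₁, g₂)` produced by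
`exists_hessianBound_extension_split` (§T2) has THE SAME doubling-step data as `(f₁, f₂)`
(`exists_hessianBound_extension_split_window`): the global hypotheses `ContDiff ℝ 2`, `DependsOn`, `HessianBound (g₁+g₂) λ`
of `abs_cubeCov_le_doubling'` ∕ `abs_cubeCov_le_doubling₀` (G8 §D–§E, edition module V) hold for `(g₁, g₂)` while its
hypotheses `hβ hγ` and its conclusion read identically for `(f₁, f₂)` — i.e. the doubling step holds under convexity
NEAR the window only.  [folklore] -/

section Window

open Literature.Probability.Distributions (coordGradient)

variable {n : ℕ} {S : ℝ} {f g F F' G G' : (Fin n → ℝ) → ℝ}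

/-- `Z_K` sees `f` on the window only. [cite: Durrett2019, Thm 1.4.7 (v)] -/
theorem cubeMass_congr (hfg : EqOn g f (cube n S)) : cubeMass g S = cubeMass f S :=
  setIntegral_congr_fun (measurableSet_cube' n S) fun x hx => by simp only [hfg hx]

/-- `⟨F⟩_K` sees `f, F` on the window only. [cite: Durrett2019, Thm 1.4.7 (v)] -/
theorem cubeMean_congr (hfg : EqOn g f (cube n S)) (hF : EqOn F' F (cube n S)) :
    cubeMean g S F' = cubeMean f S F := by
  unfold cubeMean
  rw [cubeMass_congr hfg]
  congr 1
  exact setIntegral_congr_fun (measurableSet_cube' n S) fun x hx => by simp only [hfg hx, hF hx]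

/-- `Cov_K(F,G)` sees `f, F, G` on the window only. [cite: Durrett2019, Thm 1.4.7 (v)] -/
theorem cubeCov_congr (hfg : EqOn g f (cube n S)) (hF : EqOn F' F (cube n S)) (hG : EqOn G' G (cube n S)) :
    cubeCov g S F' G' = cubeCov f S F G := by
  unfold cubeCov
  rw [cubeMass_congr hfg, cubeMean_congr hfg hF, cubeMean_congr hfg hG]
  congr 1
  exact setIntegral_congr_fun (measurableSet_cube' n S) fun x hx => by simp only [hfg hx, hF hx, hG hx]

/-- The shell-conditional mass at a window point sees `f` on the window only.
[cite: Durrett2019, Thm 1.4.7 (v); FriedliVelenik2017, Lemma 6.7 (6.7)] -/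
theorem shellMass_congr (lab : Fin n → Fin 3) (hfg : EqOn g f (cube n S)) {x : Fin n → ℝ}
    (hx : x ∈ cube n S) : shellMass lab g S x = shellMass lab f S x :=
  setIntegral_congr_fun (measurableSet_cube' n S) fun z hz => by simp only [hfg (merge_mem_cube hx hz)]

/-- The shell-conditional mean at a window point sees `f, F` on the window only.
[cite: Durrett2019, Thm 1.4.7 (v); FriedliVelenik2017, Lemma 6.7 (6.7)] -/
theorem shellMean_congr (lab : Fin n → Fin 3) (hfg : EqOn g f (cube n S)) (hF : EqOn F' F (cube n S))
    {x : Fin n → ℝ} (hx : x ∈ cube n S) : shellMean lab g S F' x = shellMean lab f S F x := by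
  unfold shellMean
  rw [shellMass_congr lab hfg hx]
  congr 1
  exact setIntegral_congr_fun (measurableSet_cube' n S) fun z hz => by
    simp only [hfg (merge_mem_cube hx hz), hF (merge_mem_cube hx hz)]

/-- The shell-conditional covariance at a window point sees `f, F, G` on the window only.
[cite: Durrett2019, Thm 1.4.7 (v); FriedliVelenik2017, Lemma 6.7 (6.7)] -/
theorem shellCov_congr (lab : Fin n → Fin 3) (hfg : EqOn g f (cube n S)) (hF : EqOn F' F (cube n S))
    (hG : EqOn G' G (cube n S)) {x : Fin n → ℝ} (hx : x ∈ cube n S) :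
    shellCov lab g S F' G' x = shellCov lab f S F G x := by
  unfold shellCov
  rw [shellMean_congr lab hfg hF hx, shellMean_congr lab hfg hG hx,
    shellMean_congr lab hfg (F' := fun y => F' y * G' y) (F := fun y => F y * G y)
      (fun y hy => by simp only [hF hy, hG hy]) hx]

/-- The shell-gradient observable `y ↦ ∂_j f(y)` sees `fderiv ℝ f` on the window only. [cite: Spivak1965, Thm 2-7] -/
theorem coordGradient_congr_of_fderiv (h : ∀ x ∈ cube n S, fderiv ℝ g x = fderiv ℝ f x) (j : Fin n) :
    EqOn (fun y => coordGradient g y j) (fun y => coordGradient f y j) (cube n S) := fun y hy => by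
  simp only [coordGradient, h y hy]

/-- THE SEAM IN DOUBLING-STEP FORM.  Under convexity NEAR the window (`HessianBoundOn (f₁ + f₂) (cube n S') λ`,
`S < S'`) with the inside ∕ outside blindness of G8 (`f₁` blind to label `2`, `f₂` blind to label `0`), there are
global `C²` potentials `g₁, g₂` with the same blindness and GLOBAL `HessianBound (g₁ + g₂) λ` whose cube covariances,
shell-conditional covariances at window points, and shell-gradient conditional covariances at window points are
LITERALLY those of `(f₁, f₂)` — so `abs_cubeCov_le_doubling₀` applied to `(g₁, g₂)` is the doubling inequality for
`(f₁, f₂)`. [cite: Durrett2019, Thm 1.4.7 (v); FriedliVelenik2017, Lemma 6.3; Spivak1965, Thm 2-7] -/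
theorem exists_hessianBound_extension_split_window {S S' lam : ℝ} (hS : 0 ≤ S) (hSS' : S < S')
    (lab : Fin n → Fin 3) {f₁ f₂ : (Fin n → ℝ) → ℝ} (hf₁ : ContDiff ℝ 2 f₁) (hf₂ : ContDiff ℝ 2 f₂)
    (hd₁ : DependsOn f₁ {i | lab i ≠ 2}) (hd₂ : DependsOn f₂ {i | lab i ≠ 0})
    (hB : HessianBoundOn (f₁ + f₂) (cube n S') lam) :
    ∃ g₁ g₂ : (Fin n → ℝ) → ℝ, ContDiff ℝ 2 g₁ ∧ ContDiff ℝ 2 g₂ ∧ DependsOn g₁ {i | lab i ≠ 2} ∧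
      DependsOn g₂ {i | lab i ≠ 0} ∧ HessianBound (g₁ + g₂) lam ∧
      (∀ F H, cubeCov (g₁ + g₂) S F H = cubeCov (f₁ + f₂) S F H) ∧
      (∀ F G, ∀ x ∈ cube n S, shellCov lab g₁ S F G x = shellCov lab f₁ S F G x) ∧
      (∀ F G, ∀ x ∈ cube n S, shellCov lab g₂ S F G x = shellCov lab f₂ S F G x) ∧
      (∀ F (j : Fin n), ∀ x ∈ cube n S, shellCov lab g₁ S F (fun y => coordGradient g₁ y j) x =
          shellCov lab f₁ S F (fun y => coordGradient f₁ y j) x) ∧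
      ∀ H (j : Fin n), ∀ x ∈ cube n S, shellCov lab g₂ S H (fun y => coordGradient g₂ y j) x =
          shellCov lab f₂ S H (fun y => coordGradient f₂ y j) x := by
  have hA : {i | lab i ≠ 2}ᶜ ⊆ {i | lab i ≠ 0} := by
    intro i hi
    simp only [mem_compl_iff, mem_setOf_eq, not_not] at hi
    simp only [mem_setOf_eq, hi]
    decide
  obtain ⟨g₁, g₂, hg₁, hg₂, hg₁d, hg₂d, hgB, he₁, he₂, hD₁, hD₂⟩ :=
    exists_hessianBound_extension_split hS hSS' hf₁ hf₂ hd₁ hd₂ hA hB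
  have he : EqOn (g₁ + g₂) (f₁ + f₂) (cube n S) := fun x hx => by
    simp only [Pi.add_apply, he₁ x hx, he₂ x hx]
  refine ⟨g₁, g₂, hg₁, hg₂, hg₁d, hg₂d, hgB, fun F H => cubeCov_congr he (fun _ _ => rfl) (fun _ _ => rfl),
    fun F G x hx => shellCov_congr lab he₁ (fun _ _ => rfl) (fun _ _ => rfl) hx,
    fun F G x hx => shellCov_congr lab he₂ (fun _ _ => rfl) (fun _ _ => rfl) hx,
    fun F j x hx => shellCov_congr lab he₁ (fun _ _ => rfl) (coordGradient_congr_of_fderiv hD₁ j) hx,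
    fun H j x hx => shellCov_congr lab he₂ (fun _ _ => rfl) (coordGradient_congr_of_fderiv hD₂ j) hx⟩

end Window

/-! ## §T5 The doubling step under convexity NEAR the window only (end-to-end composition with tree module V)

Module V's `abs_cubeCov_le_doubling₀` asks for a GLOBAL `HessianBound (f₁ + f₂) λ`; by §T4 the pair `(g₁, g₂)` of the
tree's convex extension carries literally the same doubling-step data as `(f₁, f₂)`, so the step holds under
`HessianBoundOn (f₁ + f₂) (cube n S') λ` on a slightly larger cube `S < S'` — the exact OUTPUT shape of the pub-balaban
certificates `T4CubeChartExpHessian.hessianBoundOn_expJacRep_add` ∕ `T4CubeChartGnomonic.hessianBound_gnoJac_add`.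
[folklore] (composition of §T4 with module V) -/

section Local

open Literature.Probability.Distributions (coordGradient)
open Literature.MathematicalPhysics.QuantumFieldTheory.Balaban1983to89.T4CubeShellDoubling (abs_cubeCov_le_doubling₀)

variable {n : ℕ}

/-- **THE DOUBLING STEP UNDER LOCAL CONVEXITY.**  `0 < S < S'`, `0 < λ`; `f₁, f₂ ∈ C²` with `f₁` blind to the outside
block, `f₂` blind to the inside block, `Hess(f₁ + f₂) ≥ λ` ON THE CUBE `[-S',S']ⁿ` only; `F ∈ C¹` a function of the
inside block, `H ∈ C¹` of the outside block; shell-indexed bounds `β`, `γ` on the conditional covariances of `F`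
(resp. `H`) with the shell gradients of `f₁` (resp. `f₂`) at window points, of `ℓ²`-size `≤ a`, `≤ b`.  Then
`|Cov_K(F, H)| ≤ λ⁻¹ · a · b` — module V's `abs_cubeCov_le_doubling₀` transported through
`exists_hessianBound_extension_split_window`.
[cite: BrascampLieb1976, Thm 4.1; FriedliVelenik2017, Exercise 3.11 (3.26); GlimmJaffe1987, Cor. 4.3.4 (proof); Durrett2019, Thm 1.4.7 (v)] -/
theorem abs_cubeCov_le_doubling_local {S S' lam : ℝ} (hS : 0 < S) (hSS' : S < S') (hlam : 0 < lam)
    (lab : Fin n → Fin 3) {f₁ f₂ F H : (Fin n → ℝ) → ℝ} (hf₁ : ContDiff ℝ 2 f₁) (hf₂ : ContDiff ℝ 2 f₂)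
    (hB : HessianBoundOn (f₁ + f₂) (cube n S') lam) (hF : ContDiff ℝ 1 F) (hH : ContDiff ℝ 1 H)
    (hf₁d : DependsOn f₁ {i | lab i ≠ 2}) (hFd : DependsOn F {i | lab i = 0})
    (hf₂d : DependsOn f₂ {i | lab i ≠ 0}) (hHd : DependsOn H {i | lab i = 2})
    {β γ : Fin n → ℝ} {a b : ℝ} (ha : 0 ≤ a) (hb : 0 ≤ b)
    (hβ : ∀ x ∈ cube n S, ∀ j, lab j = 1 → |shellCov lab f₁ S F (fun y => coordGradient f₁ y j) x| ≤ β j)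
    (hγ : ∀ x ∈ cube n S, ∀ j, lab j = 1 → |shellCov lab f₂ S H (fun y => coordGradient f₂ y j) x| ≤ γ j)
    (hβa : ∑ j ∈ Finset.univ.filter (fun j => lab j = 1), β j ^ 2 ≤ a ^ 2)
    (hγb : ∑ j ∈ Finset.univ.filter (fun j => lab j = 1), γ j ^ 2 ≤ b ^ 2) :
    |cubeCov (f₁ + f₂) S F H| ≤ lam⁻¹ * a * b := by
  obtain ⟨g₁, g₂, hg₁, hg₂, hg₁d, hg₂d, hgB, hcov, -, -, hsc₁, hsc₂⟩ :=
    exists_hessianBound_extension_split_window hS.le hSS' lab hf₁ hf₂ hf₁d hf₂d hB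
  rw [← hcov F H]
  exact abs_cubeCov_le_doubling₀ hS hlam lab hg₁ hg₂ hgB hF hH hg₁d hFd hg₂d hHd ha hb
    (fun x hx j hj => by rw [hsc₁ F j x hx]; exact hβ x hx j hj)
    (fun x hx j hj => by rw [hsc₂ H j x hx]; exact hγ x hx j hj) hβa hγb

end Local

end Literature.MathematicalPhysics.QuantumFieldTheory.Balaban1983to89.T4CubeShellSeam
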